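import Summits.ABC.IUTFork.Cor312PilotIdelesM
import Summits.ABC.IUTFork.Cor312PilotIdelesMThetaSide
import Summits.ABC.IUTFork.Cor312ThetaFinitePrVolMSharp
import Summits.ABC.IUTFork.Cor312VolumeVehiclesMono
import Summits.ABC.IUTFork.Cor312VolumesSummandsBridge
import HarnessLib

/-!
# [IUTchIII] Cor. 3.12 at the M-LEVEL genuine sharp setting of record: `0 ≤ −|log(Θ)|(𝟙)` — every local Θ-term of the
# trivial configuration is `≥ 0` (box ≤ hull with unit boxes)

PROOF-ONLY support piece of the abc-iut cell (Cor. 3.12 cone, D-0067; seat abc-iut-w4-d107, gen 5; part 19 of the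
`Cor312NegLogThetaUpperPrVol*` / `Cor312RegimeVerbatimPrVol*` chain — companion of parts 16–17 `Cor312RegimeExactM`,
`Cor312RegimeExactMGenuine`, independent of them). TAKES NO SIDE on [IUTchIII] Cor. 3.12; theorems only, 0 `def`s, no new
`Prop` fact, no instance.

Parts 16–17 reduced the typed Statement at abc-iut-s2-p8's summand-route M-level setting `settingPrVolSharpM` to the local
Θ-terms at the bad rational places and the ONE number `−|log(Θ)|(𝟙)` (Θ-volume of the trivial idele configuration at the
M-level: the hull inflation of the unit boxes at the packets of the genuine carriers `K_{v̲}`). THIS FILE: that number is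
`≥ 0`, and so is every local term of the trivial configuration — box ≤ hull (abc-iut-c312-5/c312-6's generic
`logvol_thetaRegion_le_thetaLocal_of_mono` with `LogvolMono` from abc-iut-w4-d013's `realizes_situationPrVolM`, `ThetaFinite`
and `ThetaRegionsAdm` from abc-iut-w5-d166/s2-p9) applied to the UNIT boxes, whose own log-volume is `0`
(abc-iut-s2-p8 `logvol_thetaRegion3_settingPrVolSharpM_non`):

* `thetaLocal_untopD_settingPrVolSharpM_trivial_nonneg` — `0 ≤ −|log(Θ)|_{i+1,v_ℚ}(𝟙)` at every `(i+1, v_ℚ)` (`= 0` at `∞`);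
* **`negLogTheta_settingPrVolSharpM_trivial_nonneg`** — `0 ≤ −|log(Θ)|(𝟙)` at the M-level;
* `thetaLocal_settingPrVolSharpM_trivial_eq_zero_of_good` — at an odd rational place `u` with `p_u ∤ disc K` the local term of the
  trivial configuration is `0` (abc-iut-w5-d166's `thetaLocal_settingPrVolM_sharp_eq_zero`, [IUTchIV] Thm. 1.10 Step (vi)), so
  **`negLogTheta_settingPrVolSharpM_trivial_eq_sum`**: `−|log(Θ)|(𝟙) = PN_i Σ_{u∈Bad} −|log(Θ)|_{i+1,u}(𝟙)` for ANY finite set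
  `Bad` of rational places containing those of residue characteristic `2` or dividing `disc K` — the M-level Θ-volume of the
  trivial configuration is SUPPORTED ON THE DYADIC AND RAMIFIED PACKETS of `K`.
(The strict positivity at the ramified/dyadic packets of `K_{v̲}` — every `K ∋ √−1` — would follow from an M-level port of
abc-iut-c312-5's ramified hull gain; not done here.) HONEST SCOPE: bookkeeping about OUR typed objects ((Ind2) as typed;
sharp (Ind3) reading; trivial archimedean container); nothing here asserts or denies [IUTchIII] Cor. 3.12 for initial
Θ-data. typed ≠ proved; instantiated ≠ endorsed. [claim: Mochizuki2012, status: disputed] [cite: DupuyHilado2025, §3.9, §4.9]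
-/

noncomputable section

open Set Function NumberField IsDedekindDomain
open scoped Pointwise

namespace Summit.ABC.IUTFork.Thm311.Real

open Cor312 Cor312.Setting Cor312Vol Literature.IUT.LogThetaLattice Literature.IUT.LogVolume Literature.IUT.HodgeTheaters
  Literature.NumberTheory.NumberFields

variable {F K Fbar : Type} [Field F] [NumberField F] [Field K] [NumberField K] [Algebra F K]
  [Field Fbar] [Algebra F Fbar] [Algebra K Fbar] {E : WeierstrassCurve F} [E.IsElliptic] {l : ℕ}
  {Pb : BadPlacePredicates K} (D : InitialThetaData F K Fbar E l Pb) {logvK : PadicLogsVal K}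
  (hlog : LogvAnalyticVal logvK)

variable (M : Type) [Field M] [NumberField M]
  (archPk : ∀ (j : (thetaIndexOfInitial D).Label) (vQ : (thetaIndexOfInitial D).VQ),
    Set ((logShellsOfInitialDH D logvK).Packet j vQ))
  (archSub : ∀ (j : (thetaIndexOfInitial D).Label) (v : (thetaIndexOfInitial D).V),
    Set ((logShellsOfInitialDH D logvK).Packet j ((thetaIndexOfInitial D).over v)))
  (Ψ : ℤ → ∀ v : (thetaIndexOfInitial D).V, v ∈ (thetaIndexOfInitial D).Vbad →
    Set ((logShellsOfInitialDH D logvK).StarPacket v))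
  (act : ℤ → ∀ v : (thetaIndexOfInitial D).V, v ∈ (thetaIndexOfInitial D).Vbad →
    (logShellsOfInitialDH D logvK).StarPacket v → Module.End ℚ ((logShellsOfInitialDH D logvK).StarPacket v))
  (Mmod : ℤ → ∀ j : (thetaIndexOfInitial D).LabelStar, Set ((logShellsOfInitialDH D logvK).GlobalPacket j.1))
  (region : ℤ → ∀ j : (thetaIndexOfInitial D).LabelStar, FinDivisor M → ∀ vQ : (thetaIndexOfInitial D).VQ,
    Set ((logShellsOfInitialDH D logvK).Packet j.1 vQ))
  (n : ℤ) {HT : Type} {LogLink : HT → HT → Type} {IsFull : ∀ {s t : HT}, LogLink s t → Prop}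
  (lat : LGPGaussianLogThetaLattice LogLink IsFull)
  {Frd : Type} {IsoF : Frd → Frd → Type} {Ob : Frd → Type} {realify : Frd → Frd} {Strip : Type}
  {IsoS : Strip → Strip → Type} {Mv : ∀ v : (thetaIndexOfInitial D).V, v ∈ (thetaIndexOfInitial D).Vbad → Type}
  [∀ v h, Monoid (Mv v h)]
  (sig : GlobalLGPFrobenioidSignature (thetaIndexOfInitial D).lstar (thetaIndexOfInitial D).V
    (· ∈ (thetaIndexOfInitial D).Vbad) Frd IsoF Ob realify Strip IsoS Mv)
  (split : SplittingMonoids Mv) {ObΔ : Type} {N : ∀ v : (thetaIndexOfInitial D).V, v ∈ (thetaIndexOfInitial D).Vbad → Type}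
  [∀ v h, Monoid (N v h)] (qData : QPilotData ObΔ N)

/-- **Every local Θ-term of the trivial configuration at the M-level is `≥ 0`**: at `∞` it is `0` (trivial archimedean
container); at a finite rational place, box ≤ hull (`logvol_thetaRegion_le_thetaLocal_of_mono` with `LogvolMono`,
`ThetaFinite`, `ThetaRegionsAdm` of `settingPrVolSharpM`) and the unit box has log-volume `0`. [cite: DupuyHilado2025, §3.9] -/
theorem thetaLocal_untopD_settingPrVolSharpM_trivial_nonneg (i : Fin (thetaIndexOfInitial D).lstar)
    (vQ : (thetaIndexOfInitial D).VQ) :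
    0 ≤ ((settingPrVolSharpM D hlog (fun _ _ _ => 1) (fun _ _ => 1) M archPk archSub Ψ act Mmod region n lat sig split qData
      (fun _ _ => one_ne_zero) ∅ (fun _ _ _ => norm_one)).thetaLocal (Setting.labelSucc i) vQ).untopD 0 := by
  rcases vQ with w | u
  · have h : (settingPrVolSharpM D hlog (fun _ _ _ => 1) (fun _ _ => 1) M archPk archSub Ψ act Mmod region n lat sig split
        qData (fun _ _ => one_ne_zero) ∅ (fun _ _ _ => norm_one)).thetaLocal (Setting.labelSucc i) (Sum.inl w) =
        ((0 : ℝ) : WithTop ℝ) :=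
      thetaLocal_settingPrVolM_arc D hlog M archPk archSub Ψ act Mmod region n lat sig split qData _ _ _ _
        (Setting.labelSucc i) w
    rw [h, WithTop.untopD_coe]
  · have hmono : LogvolMono (settingPrVolSharpM D hlog (fun _ _ _ => 1) (fun _ _ => 1) M archPk archSub Ψ act Mmod region
        n lat sig split qData (fun _ _ => one_ne_zero) ∅ (fun _ _ _ => norm_one)) :=
      SummandPieces.logvolMono_of_realizes (realizes_situationPrVolM D hlog M archPk archSub Ψ act Mmod region n)
    have hfin : (settingPrVolSharpM D hlog (fun _ _ _ => 1) (fun _ _ => 1) M archPk archSub Ψ act Mmod region n lat sig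
        split qData (fun _ _ => one_ne_zero) ∅ (fun _ _ _ => norm_one)).ThetaFinite :=
      thetaFinite_settingPrVolM_sharp D hlog M archPk archSub Ψ act Mmod region n lat sig split qData (fun _ _ _ => 1)
        (fun _ _ => 1) (fun _ _ => one_ne_zero) _ (fun _ _ _ => one_ne_zero) ∅ (fun _ _ _ _ => norm_one)
    have hadm : ThetaRegionsAdm (settingPrVolSharpM D hlog (fun _ _ _ => 1) (fun _ _ => 1) M archPk archSub Ψ act Mmod
        region n lat sig split qData (fun _ _ => one_ne_zero) ∅ (fun _ _ _ => norm_one)) :=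
      thetaRegionsAdm_settingPrVolM_sharp D hlog M archPk archSub Ψ act Mmod region n lat sig split qData (fun _ _ _ => 1)
        (fun _ _ => 1) (fun _ _ => one_ne_zero) _ (fun _ _ _ => one_ne_zero)
    have h := logvol_thetaRegion_le_thetaLocal_of_mono hmono hfin hadm 0 i (Val.non u)
    have h3 := logvol_thetaRegion3_settingPrVolSharpM_non D hlog (fun _ _ _ => 1) (fun _ _ => 1) M archPk archSub Ψ act
      Mmod region n lat sig split qData (fun _ _ => one_ne_zero) ∅ (fun _ _ _ => norm_one) (fun _ _ _ => one_ne_zero) i u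
    have hreg : (settingPrVolSharpM D hlog (fun _ _ _ => 1) (fun _ _ => 1) M archPk archSub Ψ act Mmod region n lat sig
        split qData (fun _ _ => one_ne_zero) ∅ (fun _ _ _ => norm_one)).thetaRegion 0 (Setting.labelSucc i) (Val.non u) =
        (settingPrVolSharpM D hlog (fun _ _ _ => 1) (fun _ _ => 1) M archPk archSub Ψ act Mmod region n lat sig split
          qData (fun _ _ => one_ne_zero) ∅ (fun _ _ _ => norm_one)).thetaRegion3 (Setting.labelSucc i) (Val.non u) := by
      rw [thetaRegion3_settingPrVolSharpM]
      rfl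
    have hvol : ((situationPrVolM D hlog M archPk archSub Ψ act Mmod region).D n).logvol (Setting.labelSucc i) (Val.non u)
        ((settingPrVolSharpM D hlog (fun _ _ _ => 1) (fun _ _ => 1) M archPk archSub Ψ act Mmod region n lat sig split
          qData (fun _ _ => one_ne_zero) ∅ (fun _ _ _ => norm_one)).thetaRegion 0 (Setting.labelSucc i) (Val.non u)) = 0 := by
      rw [hreg, h3]
      exact Finset.sum_eq_zero fun e _ => by rw [norm_one, Real.log_one, mul_zero]
    exact hvol.symm.le.trans h

/-- **`0 ≤ −|log(Θ)|(𝟙)` AT THE M-LEVEL**: the Θ-volume of the trivial configuration at abc-iut-s2-p8's summand-route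
sharp setting is a nonnegative real (every local term is `≥ 0`, finitely many are non-zero, the procession normalisation
is an average). [cite: DupuyHilado2025, §3.9] [claim: Mochizuki2012, status: disputed] -/
theorem negLogTheta_settingPrVolSharpM_trivial_nonneg :
    (0 : WithTop ℝ) ≤
      (settingPrVolSharpM D hlog (fun _ _ _ => 1) (fun _ _ => 1) M archPk archSub Ψ act Mmod region n lat sig split qData
        (fun _ _ => one_ne_zero) ∅ (fun _ _ _ => norm_one)).negLogTheta := by
  have hfin : (settingPrVolSharpM D hlog (fun _ _ _ => 1) (fun _ _ => 1) M archPk archSub Ψ act Mmod region n lat sig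
      split qData (fun _ _ => one_ne_zero) ∅ (fun _ _ _ => norm_one)).ThetaFinite :=
    thetaFinite_settingPrVolM_sharp D hlog M archPk archSub Ψ act Mmod region n lat sig split qData (fun _ _ _ => 1)
      (fun _ _ => 1) (fun _ _ => one_ne_zero) _ (fun _ _ _ => one_ne_zero) ∅ (fun _ _ _ _ => norm_one)
  have hnn := thetaLocal_untopD_settingPrVolSharpM_trivial_nonneg D hlog M archPk archSub Ψ act Mmod region n lat sig split
    qData
  unfold Setting.negLogTheta
  rw [if_pos hfin]
  refine WithTop.coe_nonneg.mpr ?_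
  unfold processionNormalized
  exact div_nonneg (Finset.sum_nonneg fun i _ => finsum_nonneg (hnn i)) (Nat.cast_nonneg _)

/-- **At an odd rational place `u` with `p_u ∤ disc(K)` the local Θ-term of the trivial configuration is `0`** (unit boxes at
a good packet: abc-iut-w5-d166's `thetaLocal_settingPrVolM_sharp_eq_zero`; [IUTchIV] Thm. 1.10 Step (vi)).
[cite: Mochizuki2012, IUTchIV Thm 1.10 proof Step (vi) p. 29] -/
theorem thetaLocal_settingPrVolSharpM_trivial_eq_zero_of_good (i : Fin (thetaIndexOfInitial D).lstar) (u : FinitePlace ℚ)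
    (hp2 : 2 < ratChar u) (hdisc : ¬ ((ratChar u : ℕ) : ℤ) ∣ NumberField.discr K) :
    (settingPrVolSharpM D hlog (fun _ _ _ => 1) (fun _ _ => 1) M archPk archSub Ψ act Mmod region n lat sig split qData
        (fun _ _ => one_ne_zero) ∅ (fun _ _ _ => norm_one)).thetaLocal (Setting.labelSucc i) (Val.non u) =
      ((0 : ℝ) : WithTop ℝ) :=
  thetaLocal_settingPrVolM_sharp_eq_zero D hlog M archPk archSub Ψ act Mmod region n lat sig split qData (fun _ _ _ => 1)
    (fun _ _ => 1) (fun _ _ => one_ne_zero) _ (fun _ _ _ => one_ne_zero) i u hp2 hdisc fun _ => norm_one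

open scoped Classical in
/-- **`−|log(Θ)|(𝟙)` at the M-level is SUPPORTED ON THE DYADIC AND RAMIFIED PACKETS of `K`**: for any finite set `Bad` of
rational places containing every `u` of residue characteristic `≤ 2` or dividing `disc(K)`,
`−|log(Θ)|(𝟙) = PN_i Σ_{u∈Bad} −|log(Θ)|_{i+1,u}(𝟙)` (the other local terms vanish: `∞` by the trivial archimedean container,
good odd places by the previous theorem). [cite: Mochizuki2012, IUTchIV Thm 1.10 proof Step (vi) p. 29]
[claim: Mochizuki2012, status: disputed] -/
theorem negLogTheta_settingPrVolSharpM_trivial_eq_sum (Bad : Finset (FinitePlace ℚ))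
    (hBad2 : ∀ u : FinitePlace ℚ, ratChar u ≤ 2 → u ∈ Bad)
    (hBadD : ∀ u : FinitePlace ℚ, ((ratChar u : ℕ) : ℤ) ∣ NumberField.discr K → u ∈ Bad) :
    (settingPrVolSharpM D hlog (fun _ _ _ => 1) (fun _ _ => 1) M archPk archSub Ψ act Mmod region n lat sig split qData
        (fun _ _ => one_ne_zero) ∅ (fun _ _ _ => norm_one)).negLogTheta =
      ((processionNormalized (fun i : Fin (thetaIndexOfInitial D).lstar => ∑ u ∈ Bad,
          ((settingPrVolSharpM D hlog (fun _ _ _ => 1) (fun _ _ => 1) M archPk archSub Ψ act Mmod region n lat sig split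
            qData (fun _ _ => one_ne_zero) ∅ (fun _ _ _ => norm_one)).thetaLocal (Setting.labelSucc i) (Val.non u)).untopD 0)
        : ℝ) : WithTop ℝ) := by
  have hfin : (settingPrVolSharpM D hlog (fun _ _ _ => 1) (fun _ _ => 1) M archPk archSub Ψ act Mmod region n lat sig
      split qData (fun _ _ => one_ne_zero) ∅ (fun _ _ _ => norm_one)).ThetaFinite :=
    thetaFinite_settingPrVolM_sharp D hlog M archPk archSub Ψ act Mmod region n lat sig split qData (fun _ _ _ => 1)
      (fun _ _ => 1) (fun _ _ => one_ne_zero) _ (fun _ _ _ => one_ne_zero) ∅ (fun _ _ _ _ => norm_one)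
  unfold Setting.negLogTheta
  rw [if_pos hfin, WithTop.coe_inj]
  refine congrArg processionNormalized (funext fun i => ?_)
  set f1 : (thetaIndexOfInitial D).VQ → ℝ := fun vQ =>
    ((settingPrVolSharpM D hlog (fun _ _ _ => 1) (fun _ _ => 1) M archPk archSub Ψ act Mmod region n lat sig split qData
      (fun _ _ => one_ne_zero) ∅ (fun _ _ _ => norm_one)).thetaLocal (Setting.labelSucc i) vQ).untopD 0 with hf1
  have hsupp : (Function.support f1) ⊆
      ((Bad.map ⟨(Val.non : FinitePlace ℚ → (thetaIndexOfInitial D).VQ), fun _ _ h => Sum.inr_injective h⟩ :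
        Finset (thetaIndexOfInitial D).VQ) : Set (thetaIndexOfInitial D).VQ) := by
    intro vQ hvQ
    rw [Function.mem_support] at hvQ
    rcases vQ with w | u
    · refine absurd ?_ hvQ
      show f1 (Sum.inl w) = 0
      rw [hf1]
      show ((settingPrVolSharpM D hlog (fun _ _ _ => 1) (fun _ _ => 1) M archPk archSub Ψ act Mmod region n lat sig split
        qData (fun _ _ => one_ne_zero) ∅ (fun _ _ _ => norm_one)).thetaLocal (Setting.labelSucc i) (Sum.inl w)).untopD 0 = 0
      have h : (settingPrVolSharpM D hlog (fun _ _ _ => 1) (fun _ _ => 1) M archPk archSub Ψ act Mmod region n lat sig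
          split qData (fun _ _ => one_ne_zero) ∅ (fun _ _ _ => norm_one)).thetaLocal (Setting.labelSucc i) (Sum.inl w) =
          ((0 : ℝ) : WithTop ℝ) :=
        thetaLocal_settingPrVolM_arc D hlog M archPk archSub Ψ act Mmod region n lat sig split qData _ _ _ _
          (Setting.labelSucc i) w
      rw [h, WithTop.untopD_coe]
    · rw [Finset.coe_map, Set.mem_image]
      by_cases hu : u ∈ Bad
      · exact ⟨u, Finset.mem_coe.mpr hu, rfl⟩
      · refine absurd ?_ hvQ
        have hp2 : 2 < ratChar u := by
          by_contra h; exact hu (hBad2 u (not_lt.mp h))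
        have hdisc : ¬ ((ratChar u : ℕ) : ℤ) ∣ NumberField.discr K := fun h => hu (hBadD u h)
        show f1 (Sum.inr u) = 0
        rw [hf1]
        show ((settingPrVolSharpM D hlog (fun _ _ _ => 1) (fun _ _ => 1) M archPk archSub Ψ act Mmod region n lat sig split
          qData (fun _ _ => one_ne_zero) ∅ (fun _ _ _ => norm_one)).thetaLocal (Setting.labelSucc i) (Val.non u)).untopD 0 = 0
        rw [thetaLocal_settingPrVolSharpM_trivial_eq_zero_of_good D hlog M archPk archSub Ψ act Mmod region n lat sig split
          qData i u hp2 hdisc, WithTop.untopD_coe]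
  show ∑ᶠ vQ, f1 vQ = ∑ u ∈ Bad, f1 (Val.non u)
  rw [finsum_eq_sum_of_support_subset f1 hsupp, Finset.sum_map]
  rfl

end Summit.ABC.IUTFork.Thm311.Real

end
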